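import Literature.MathematicalPhysics.QuantumFieldTheory.Balaban1983to89.B3Ineq25Op116RegularRegionOneSided
import Literature.MathematicalPhysics.QuantumFieldTheory.Balaban1983to89.B3Op116KernelRegularTorusDecay
import Literature.MathematicalPhysics.QuantumFieldTheory.Balaban1983to89.B3Op116BoxRows

/-!
# Bałaban, *(Higgs)₂,₃ quantum fields in a finite volume III. Renormalization* [B3] — inequality (2.5) p. 424, THE (1.16) ALTERNATIVE, ON
A REGION UNDER PRINT'S REGIME ONLY (nested big-block unions `Ω₂ ⊆ Ω ⊆ T_ε`, print's support hypothesis p. 412), AT THE ONE-SIDED ORDERS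
`(0, n′)` AND `(n′, 0)`, `n′ > d`: the inputs of `B3Ineq25Op116RegularRegionOneSided` DISCHARGED by the tree's hypothesis-free region theorems —
the one-sided twin of p40's R5(C) `B3Ineq25Op116RegularRegion.ineq25At_op116_region`

statement-level skeleton of published theorems with citation tags; proofs where landed; nothing here is a claim about the Yang–Mills mass gap

T. Bałaban, Commun. Math. Phys. **88** (1983) 411–445 [cite: Balaban1983Higgs3]; part I, Commun. Math. Phys. **85** (1982) 603–636
[cite: Balaban1982Higgs1]; *Regularity and decay of lattice Green's functions*, Commun. Math. Phys. **89** (1983) 571–597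
[cite: Balaban1983RegularityDecay].  PDFs held: `paper:balaban1983-higgs-2-3-quantum-fields-finite-volume` (journal page = PDF page + 410;
p. 412 = `p0002.txt`, p. 414 = `p0004.txt`, p. 424 = `p0014.txt`), `paper:balaban1982-cmp85-higgs23-i` (p. 619–620 = `p0017.txt`–`p0018.txt`).

CITATION HEADER (lean-in-tree rule).  Cell `lit-balaban` (HOME `run/shared/lean/pub/lit-balaban/`), proof seat **p35** gen 23
(unit `lit-balaban-p35`); p40 g75's region programme of B3-CLOSURE §5 item 20 (R1–R5, HOME/STATUS 2026-08-23T09:21:23Z ff.), division of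
labour as on the torus (one-sided orders = p35; p35 → p40 10:50Z).  SKELETON rows **B3.Eq2.5** (decl of record
`B3Sect2StatementsPart2.ScaledKernels.Ineq25At`, fold owner r15; head = p40's R5(C) `ineq25At_op116_region` when folded) / **B3.Eq1.16**
(analytic half) — LOCATED MEMBER (the one-sided corner), no head claim.  USED BY NAME, never restated: p35's
`B3Ineq25Op116RegularRegionOneSided.{ineq25At_op116_regularRegion_zero_left, _zero_right}`, r14/r15's `B3Ineq210RegularRegion.ineq210_regularRegion_small`,
p40's `B3Ineq210MixedRegularRegion.ineq210_mixed_regularRegion`, p35's `B3Op116BoxRows.hcol_le_region`, p33's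
`B3Ineq25SmoothLocalization.ineq25_smooth_regularNested`, p35's `B3Op116KernelRegularTorusDecay.ineq210_rate_mono`; the discharge is p40's
R5(C) proof verbatim with the last line replaced (no credit claimed for the pattern).

## What is printed (verbatim)

(2.5) p. 424 [PDF 14]: *"‖h(an operator δG_k(Ω,Ω₂,B̃) or (1.16))h′‖_{1,α} ≤ O(e^{−δ₀dist(Ω₂,∂Ω)} or (e(L^kε)p(L^kε))^{n+n′})e^{−δ₀dist(supp h,
supp h′)}, (2.5)"*;  p. 412 [PDF 2]: *"we will assume that |A|, |∂^ηA|, |∂^ηB| and their Hölder norms … ≤ O(1)p(L^kε) and dist(supp A, ∂Ω) >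
2r(L^kε)"*;  (1.16) p. 414 [PDF 4];  [B1] (3.45) p. 620 [PDF 18] (the one-sided expansion whose remainder is (1.16) at `(n̄, 0)`).

## Honest scope

Print's regime only, exactly as in R5(C): nested BIG-BLOCK UNIONS, `B̃`/`Ã+B̃` regular on `Ω` and small, `Ã` small, regular, supported on deep
bonds (the tree's `DeepBlk` margin read for print's `2r(L^kε)`, GAPS G-B3-16), `n′ > d`, `0 ≤ α < 1`, `L ≥ 2`, `L^kε ≤ 1`; constants explicit,
not optimized; conclusion for the smooth localization functions of the carrier `sect2Smooth116`.  Theorem only: no `def`, no new named fact, no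
`sorry`; axioms standard.  Value = located member of a by-reference step of B3 — NOT summit progress and nothing about the Yang–Mills mass gap.
-/

noncomputable section

open scoped BigOperators

namespace Literature.MathematicalPhysics.QuantumFieldTheory.Balaban1983to89.B3Ineq25Op116RegionOneSided

open HiggsLattice (ChargeData ScalarField covDeriv)
open HiggsCovariance (propagatorK E)
open B1Eq230FluctCov (Ix cb)
open B1TorusChainTransport (hol)
open B1TorusCubeCover (half)
open B1TorusRegionHSizes (IsBigBlockUnion)
open B3Ineq210RegularRegion (regRegionKernels Interior ineq210_regularRegion_small)
open B3Ineq210MixedRegularRegion (mixedTermR ineq210_mixed_regularRegion)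
open B3Ineq211RegularTorus (IsAdm)
open B3Ineq25SmoothLocalization (sect2DeltaSmooth ineq25_smooth_regularNested)
open B3Ineq31SmoothLocalization (smoothConst)
open B3Ineq25Op116Smooth (sect2Smooth116)
open B3Op116DKernelRegularTorus (valC derC)
open B3Op116HolderKernelRegularTorus (holC)
open B3Op116MixedKernelRegularTorus (mixC)
open B3Op116KernelRegularTorusDecay (ineq210_rate_mono)
open B3Op116BoxRows (hcol_le_region)
open B3Op116RegionSources (DeepBlk)
open B3Ineq25Op116RegularRegionOneSided (ineq25At_op116_regularRegion_zero_left ineq25At_op116_regularRegion_zero_right)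

variable {P : HiggsLattice.Params} {N : ℕ}

section Plug

/-- rate weakening of a decay factor `exp(−ρ·t)`. [cite: Balaban1983Higgs3, (2.10) p.426] -/
private theorem exp_rate_mono {ρ ρ' t : ℝ} (h : ρ' ≤ ρ) (ht : 0 ≤ t) : Real.exp (-(ρ * t)) ≤ Real.exp (-(ρ' * t)) :=
  Real.exp_le_exp.mpr (by nlinarith)

/-- rate weakening of `exp(−ρ·u·s)`, `u, s ≥ 0`. [cite: Balaban1983Higgs3, (2.10) p.426] -/
private theorem exp_rate_mono3 {ρ ρ' u s : ℝ} (h : ρ' ≤ ρ) (hu : 0 ≤ u) (hs : 0 ≤ s) :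
    Real.exp (-(ρ * u * s)) ≤ Real.exp (-(ρ' * u * s)) := by
  apply Real.exp_le_exp.mpr
  have := mul_le_mul_of_nonneg_right (mul_le_mul_of_nonneg_right h hu) hs
  linarith

set_option maxHeartbeats 800000 in
/-- **INEQUALITY (2.5) OF [B3], THE (1.16) ALTERNATIVE, ON A REGION UNDER PRINT'S REGIME ONLY, AT THE ONE-SIDED ORDERS `(0, n′)` AND
`(n′, 0)`** — every order `n′ > d ≥ 1`, every Hölder index `0 ≤ α < 1`, every pair of nested big-block unions `Ω₂ ⊆ Ω ⊆ T_ε`.  For `d ≥ 1`,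
`L ≥ 2`, `a > 0`, `m² > 0`, a regularity budget `c ≥ 0`, support size `m`, bump constants `c₁, c₂ ≥ 0`: ∃ charge threshold `E₀ > 0`, ∀ charge
data with `e² ≤ E₀`, ∃ `K₀min`, ∀ `0 ≤ α < 1`, ∀ `K₀ ≥ K₀min`, ∃ `t > 0`, `0 < δ₁ ≤ 1`, `δ₀ > 0`, `C, C_M, C_H, C_G ≥ 0`, such that on every
torus `T_ε` (dimension `d`, ratio `L`, `K₀ ∣ M`), every scale `1 ≤ k ≤ K` with `≥ 3` cubes per direction and `L^kε ≤ 1`, all big-block unions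
`Ω₂ ⊆ Ω`, all backgrounds `Ã, B̃` with `B̃`, `Ã+B̃` (I.2.23)-regular ON `Ω` (`δ_B, δ_{AB} ≥ 0`), `Ã` (I.2.23)-regular (`δ_A ≥ 0`), `L^kδ_B|e| ≤ t`,
`L^kδ_{AB}|e| ≤ t`, `L^kδ_B ≤ c|e|`, `sup_b|Ã_b| ≤ s` (`s ≥ 0`), `(L^kε)|e|s ≤ 1`, AND `Ã` SUPPORTED ON DEEP BONDS OF `Ω` (print p. 412
«dist(supp Ã, ∂Ω) > 2r(L^kε)»: `Ã_b ≠ 0 ⇒ DeepBlk b₋ ∧ DeepBlk b₊`), every margin `r₀` and carrier parameters `0 ≤ e_Rp_R`, `L^kε ≤ e_Rp_R`: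
`(sect2Smooth116 hP1 C Ω Ω₂ A B …).Ineq25At 0 n′ α (min δ₀ (δ₁/(4L)^{n′+1})) K ∧ (sect2Smooth116 …).Ineq25At n′ 0 α (min δ₀ (δ₁/(4L)^{n′+1})) K`,
`K = C_G + K(c₁,c₂+2c₁,d,m)·(valC(n′)+derC(n′)) + (holC(n′−1)+holC(n′))(…ε^dC_H…) + d·m·mixC(n′)` — p35's
`ineq25At_op116_regularRegion_zero_left` / `_zero_right` with their inputs discharged exactly as in p40's R5(C) `ineq25At_op116_region`
(`ineq210_regularRegion_small` for `B̃` and `Ã+B̃` on `Ω`, `ineq210_mixed_regularRegion`, p35's `hcol_le_region` ((2.11)),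
`ineq25_smooth_regularNested` (`δG_k`), common cube size, common rate).
[cite: Balaban1983Higgs3, (2.5) p.424, (1.16) p.414, p.412, (1.32) p.420, (2.10)-(2.11) p.426] [cite: Balaban1982Higgs1, Prop. 2.1 (2.23)-(2.25) p.610, (3.44)-(3.45) p.619] [cite: Balaban1983RegularityDecay, Theorem p.573] -/
theorem ineq25At_op116_region_oneSided (d L : ℕ) (hd : 1 ≤ d) (hL : 2 ≤ L) {a : ℝ} (ha : 0 < a) {msq : ℝ} (hmsq : 0 < msq)
    {c : ℝ} (hc : 0 ≤ c) (N m : ℕ) {c₁ c₂ : ℝ} (hc₁ : 0 ≤ c₁) (hc₂ : 0 ≤ c₂)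
    (n' : ℕ) (hdn : d < n') :
    ∃ E₀ : ℝ, 0 < E₀ ∧ ∀ (C : ChargeData N), C.e ^ 2 ≤ E₀ →
      ∃ K₀min : ℕ, ∀ {α : ℝ}, 0 ≤ α → α < 1 → ∀ K₀ : ℕ, K₀min ≤ K₀ →
      ∃ t δ₁ δ₀ Cst CM CH CG : ℝ, 0 < t ∧ 0 < δ₁ ∧ δ₁ ≤ 1 ∧ 0 < δ₀ ∧ 0 ≤ Cst ∧ 0 ≤ CM ∧ 0 ≤ CH ∧ 0 ≤ CG ∧
      ∀ (P : HiggsLattice.Params) (hP1 : 1 < P.L), P.d = d → P.L = L → K₀ ∣ P.M →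
      ∀ {k : ℕ}, 1 ≤ k → k ≤ P.K → (∀ μ, 3 * half P k K₀ ≤ P.sitesPerDir 0 μ) → P.mesh k ≤ 1 →
      ∀ (Ω Ω₂ : Finset (HiggsLattice.Site P 0)), IsBigBlockUnion k K₀ Ω → IsBigBlockUnion k K₀ Ω₂ → Ω₂ ⊆ Ω →
      ∀ (A B : HiggsLattice.VecField P 0) {δB δAB δA s : ℝ}, 0 ≤ δB → 0 ≤ δAB → 0 ≤ δA → 0 ≤ s →
        (∀ z ∈ Ω, ∀ μ ν : Fin P.d, |B ⟨z.shift ν, μ⟩ - B ⟨z, μ⟩| ≤ δB) →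
        (∀ z ∈ Ω, ∀ μ ν : Fin P.d, |(A + B) ⟨z.shift ν, μ⟩ - (A + B) ⟨z, μ⟩| ≤ δAB) →
        (∀ (z : HiggsLattice.Site P 0) (μ ν : Fin P.d), |A ⟨z.shift ν, μ⟩ - A ⟨z, μ⟩| ≤ δA) →
        (P.L : ℝ) ^ k * δB * |C.e| ≤ t → (P.L : ℝ) ^ k * δAB * |C.e| ≤ t → (P.L : ℝ) ^ k * δB ≤ c * |C.e| →
        (∀ b : HiggsLattice.PBond P 0, |A b| ≤ s) → P.mesh k * (|C.e| * s) ≤ 1 →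
        (∀ b : HiggsLattice.PBond P 0, A b ≠ 0 → DeepBlk k K₀ Ω b.src ∧ DeepBlk k K₀ Ω b.tgt) →
      ∀ (r₀ : ℕ) {eR pR : ℝ}, 0 ≤ eR * pR → P.mesh k ≤ eR * pR → Ix N →
        (sect2Smooth116 hP1 C Ω Ω₂ A B msq a k K₀ r₀ m c₁ c₂ eR pR).Ineq25At 0 n' α
          (min δ₀ (δ₁ / (4 * (P.L : ℝ)) ^ (n' + 1)))
          (CG + (smoothConst P.d m c₁ (c₂ + 2 * c₁) *
              (valC P N C k a δ₁ Cst s δA n' + derC P N C k a δ₁ Cst s δA n')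
            + ((holC P N C k a δ₁ Cst s δA α (P.mesh 0 ^ P.d * CH) (n' - 1)
                + holC P N C k a δ₁ Cst s δA α (P.mesh 0 ^ P.d * CH) n')
              + P.d * m * mixC P N C k a δ₁ Cst CM s δA n'))) ∧
        (sect2Smooth116 hP1 C Ω Ω₂ A B msq a k K₀ r₀ m c₁ c₂ eR pR).Ineq25At n' 0 α
          (min δ₀ (δ₁ / (4 * (P.L : ℝ)) ^ (n' + 1)))
          (CG + (smoothConst P.d m c₁ (c₂ + 2 * c₁) *
              (valC P N C k a δ₁ Cst s δA n' + derC P N C k a δ₁ Cst s δA n')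
            + ((holC P N C k a δ₁ Cst s δA α (P.mesh 0 ^ P.d * CH) (n' - 1)
                + holC P N C k a δ₁ Cst s δA α (P.mesh 0 ^ P.d * CH) n')
              + P.d * m * mixC P N C k a δ₁ Cst CM s δA n'))) := by
  obtain ⟨E₀, hE₀, hG⟩ := ineq25_smooth_regularNested d L hd hL ha hmsq hc N m hc₁ hc₂
  refine ⟨E₀, hE₀, fun C heC => ?_⟩
  obtain ⟨K₄, hK₄⟩ := hG C heC
  obtain ⟨K₁, hK₁⟩ := ineq210_regularRegion_small d L hd hL ha hmsq N C
  obtain ⟨K₂, hK₂⟩ := ineq210_mixed_regularRegion d L hd hL ha hmsq N C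
  obtain ⟨K₃, hK₃⟩ := hcol_le_region d L hd hL ha hmsq N C
  refine ⟨max (max K₁ K₂) (max K₃ K₄), fun {α} hα0 hα1 K₀ hK₀ => ?_⟩
  obtain ⟨t₁, δ₁, C₁, ht₁, hδ₁, hC₁, h1⟩ := hK₁ K₀ ((le_max_left K₁ K₂).trans ((le_max_left _ _).trans hK₀))
  obtain ⟨t₂, δ₂, C₂, ht₂, hδ₂, hC₂, h2⟩ := hK₂ K₀ ((le_max_right K₁ K₂).trans ((le_max_left _ _).trans hK₀))
  obtain ⟨t₃, δ₃, C₃, ht₃, hδ₃, hC₃, h3⟩ := hK₃ hα0 hα1 K₀ ((le_max_left K₃ K₄).trans ((le_max_right _ _).trans hK₀))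
  obtain ⟨t₄, δ₄, C₄, ht₄, hδ₄, hC₄, h4⟩ := hK₄ hα0 hα1 K₀ ((le_max_right K₃ K₄).trans ((le_max_right _ _).trans hK₀))
  -- the common smallness threshold and the common rate
  set t : ℝ := min (min t₁ t₂) (min t₃ t₄) with htdef
  set δ : ℝ := min (min δ₁ δ₂) (min δ₃ 1) with hδdef
  have htt₁ : t ≤ t₁ := (min_le_left _ _).trans (min_le_left _ _)
  have htt₂ : t ≤ t₂ := (min_le_left _ _).trans (min_le_right _ _)
  have htt₃ : t ≤ t₃ := (min_le_right _ _).trans (min_le_left _ _)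
  have htt₄ : t ≤ t₄ := (min_le_right _ _).trans (min_le_right _ _)
  have hδδ₁ : δ ≤ δ₁ := (min_le_left _ _).trans (min_le_left _ _)
  have hδδ₂ : δ ≤ δ₂ := (min_le_left _ _).trans (min_le_right _ _)
  have hδδ₃ : δ ≤ δ₃ := (min_le_right _ _).trans (min_le_left _ _)
  have hδ1 : δ ≤ 1 := (min_le_right _ _).trans (min_le_right _ _)
  have hδ0 : 0 < δ := lt_min (lt_min hδ₁ hδ₂) (lt_min hδ₃ one_pos)
  refine ⟨t, δ, δ₄, C₁, C₂, C₃, C₄, lt_min (lt_min ht₁ ht₂) (lt_min ht₃ ht₄), hδ0, hδ1, hδ₄, hC₁.le, hC₂.le, hC₃.le, hC₄.le, ?_⟩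
  intro P hP1 hPd hPL hK₀M k hk hkK h3h hmesh Ω Ω₂ hΩ hΩ₂ hsub A B δB δAB δA s hδB hδAB hδA hs hregB hregAB hregA htB htAB hcB hA ht1
    hAS r₀ eR pR ht0 ht i₀
  have hL2 : 2 ≤ P.L := by rw [hPL]; exact hL
  have hdP : P.d < n' := by rw [hPd]; exact hdn
  have hε := P.mesh_pos 0
  -- (2.10) for `B̃` and `Ã+B̃` on `Ω` at the common rate
  have h210B : (regRegionKernels hP1 C Ω B msq a k K₀).Ineq210 δ C₁ :=
    ineq210_rate_mono hC₁.le hδδ₁ (h1 P hP1 hPd hPL hK₀M hk hkK h3h hmesh Ω hΩ B hδB hregB (htB.trans htt₁))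
  have h210AB : (regRegionKernels hP1 C Ω (A + B) msq a k K₀).Ineq210 δ C₁ :=
    ineq210_rate_mono hC₁.le hδδ₁ (h1 P hP1 hPd hPL hK₀M hk hkK h3h hmesh Ω hΩ (A + B) hδAB hregAB (htAB.trans htt₁))
  -- the twice-differentiated per-piece (2.10) on `Ω` at the common rate
  have hLj : ∀ j : ℕ, (0 : ℝ) < (P.L : ℝ) ^ j := fun j => by have := P.hL; positivity
  have hmix : ∀ (X : HiggsLattice.VecField P 0) {δX : ℝ}, 0 ≤ δX →
      (∀ z ∈ Ω, ∀ μ ν : Fin P.d, |X ⟨z.shift ν, μ⟩ - X ⟨z, μ⟩| ≤ δX) → (P.L : ℝ) ^ k * δX * |C.e| ≤ t →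
      ∀ (j : ℕ) (μ ν : Fin P.d) (x x' : HiggsLattice.Site P 0), Interior k K₀ Ω x → Interior k K₀ Ω x' →
        mixedTermR C Ω X msq a k j μ ν x x'
          ≤ C₂ * (P.mesh j ^ P.d)⁻¹ * Real.exp (-(δ * ((HiggsLattice.Site.tdist x x' : ℝ) / (P.L : ℝ) ^ j))) := by
    intro X δX hδX hregX htX j μ ν x x' hx hx'
    refine (h2 P hPd hPL hK₀M hk hkK h3h hmesh Ω hΩ X hδX hregX (htX.trans htt₂) j μ ν x x' hx hx').trans ?_
    exact mul_le_mul_of_nonneg_left (exp_rate_mono hδδ₂ (div_nonneg (Nat.cast_nonneg _) (hLj j).le))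
      (mul_nonneg hC₂.le (inv_nonneg.mpr (pow_nonneg (P.mesh_pos j).le _)))
  have hmixB := hmix B hδB hregB htB
  have hmixAB := hmix (A + B) hδAB hregAB htAB
  -- the (2.11) Hölder row of `G_k(Ω,B̃)` at interior points at the common rate
  have h211 : ∀ (μ : Fin P.d) (x₁ x₂ y : HiggsLattice.Site P 0), Interior k K₀ Ω x₁ → Interior k K₀ Ω x₂ → Interior k K₀ Ω y →
      x₁ ≠ x₂ → ∀ Γ : List (HiggsLattice.Site P 0), IsAdm x₁ x₂ Γ →
      (∑ i : Ix N, ‖hol C B x₁ Γ (covDeriv C B (propagatorK C Ω B msq a k (cb P N 0 (y, i))) ⟨x₂, μ⟩)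
          - covDeriv C B (propagatorK C Ω B msq a k (cb P N 0 (y, i))) ⟨x₁, μ⟩‖)
          / (P.mesh 0 * (HiggsLattice.Site.tdist x₁ x₂ : ℝ)) ^ α
        ≤ ∑ j ∈ Finset.range k, (P.mesh 0 ^ P.d * C₃) * P.mesh j ^ (((1 : ℝ) - α) - (P.d : ℝ)) *
            (Real.exp (-(δ * (P.mesh j)⁻¹ * (P.mesh 0 * (HiggsLattice.Site.tdist x₁ y : ℝ)))) +
              Real.exp (-(δ * (P.mesh j)⁻¹ * (P.mesh 0 * (HiggsLattice.Site.tdist x₂ y : ℝ))))) := by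
    intro μ x₁ x₂ y hx₁ hx₂ hy hne Γ hΓ
    refine (h3 P hP1 hPd hPL hK₀M hk hkK h3h hmesh Ω hΩ B hδB hregB (htB.trans htt₃) μ x₁ x₂ y hx₁ hx₂ hy hne Γ hΓ).trans ?_
    refine Finset.sum_le_sum fun j _ => ?_
    have hcj : 0 ≤ (P.mesh 0 ^ P.d * C₃) * P.mesh j ^ (((1 : ℝ) - α) - (P.d : ℝ)) :=
      mul_nonneg (mul_nonneg (pow_nonneg hε.le _) hC₃.le) (Real.rpow_nonneg (P.mesh_pos j).le _)
    refine mul_le_mul_of_nonneg_left (add_le_add ?_ ?_) hcj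
    · exact exp_rate_mono3 hδδ₃ (inv_nonneg.mpr (P.mesh_pos j).le) (mul_nonneg hε.le (Nat.cast_nonneg _))
    · exact exp_rate_mono3 hδδ₃ (inv_nonneg.mpr (P.mesh_pos j).le) (mul_nonneg hε.le (Nat.cast_nonneg _))
  -- the `δG_k(Ω,Ω₂,B̃)` clause with smooth localizations
  have hδG : (sect2DeltaSmooth hP1 C Ω Ω₂ B msq a k K₀ r₀ m c₁ c₂).Ineq25 α δ₄ C₄ :=
    h4 P hP1 hPd hPL hK₀M hk hkK h3h hmesh Ω Ω₂ hΩ hΩ₂ hsub B hδB hregB (htB.trans htt₄) hcB r₀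
  exact ⟨ineq25At_op116_regularRegion_zero_left hL2 hk hkK hsub hmsq ha hmesh n' hdP hα0 hα1 hc₁ hc₂ ht0 ht hC₄.le hδG hδ0 hδ1
      hC₁.le hC₂.le h210B hmixB h210AB hmixAB i₀ hs hA hδA hregA hAS ht1 (mul_nonneg (pow_nonneg hε.le _) hC₃.le) h211,
    ineq25At_op116_regularRegion_zero_right hL2 hk hkK hsub hmsq ha hmesh n' hdP hα0 hα1 hc₁ hc₂ ht0 ht hC₄.le hδG hδ0 hδ1
      hC₁.le hC₂.le h210B hmixB h210AB hmixAB i₀ hs hA hδA hregA hAS ht1 (mul_nonneg (pow_nonneg hε.le _) hC₃.le) h211⟩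

end Plug

end Literature.MathematicalPhysics.QuantumFieldTheory.Balaban1983to89.B3Ineq25Op116RegionOneSided

end
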